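import Mathlib
import Summits.CriticalPhenomena.CardyFormulaZ2.Theses.CardyMagicRigidity
import Literature.Probability.Percolation.FullPlaneCNL
import Literature.Probability.Percolation.LoopRepresentationProofs
import Literature.Probability.RandomPlanarGeometry.LoopConfigurationsMetric
import HarnessLib

/-!
# Gluing through a common limit: the `d_CN` transfer layer of stub `stub_transfer` (S6) of line
`ring-cloud-tomography` for crux `NestingRigidity` (stmt-CriticalPhenomena-4835)

Route `CardyMagicRigidity` (sub-problem `CriticalPhenomena/CardyFormulaZ2`). The registered stub
`stub_transfer : Transfer` (`Transfer := NestingStatisticsAgree → LoopLimitZ2EqT`) ends, after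
tightness of both lattice loop families and the identification of their subsequential limits,
with a purely measure-theoretic step (T4 of the stub brief): if along a mesh sequence `δₖ` the
typed loop ensembles of critical bond percolation on `δₖℤ²` (`bondLoopConfig δₖ 0` under
`bondPercolation (zdGraph 2) half`) and of critical site percolation on `δₖ𝕋` (`siteLoopConfig δₖ`
under `triSitePercolation half`) converge in DKKMO's coupling distance `d_CN`
(`LoopConfig.cnLawEDist`, arXiv:2012.11672v2 eq. (2)) to a COMMON law `(P, Y)`, then
`d_CN(bond_{δₖ}, site_{δₖ}) → 0`. This file proves that step, sorry-free:

* `measurableSet_isClose_bondLoopConfig_siteLoopConfig`, `measurableSet_isClose_bond_site` — the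
  MIXED exceptional event `{(ω, ω') | d_CN(bondLoopConfig δ α ω, siteLoopConfig δ' ω') ≤ ε}` is
  measurable on `BondConfig (Site 2) × SiteConfig (Site 2)` (both representations are countably
  generated with measurable generating events: `gen_bondLoopConfig`,
  `measurableSet_setOf_isInterfaceLoop_and`, `gen_siteLoopConfig`,
  `measurableSet_gen_siteLoopConfig`, `countable_sigma_hexLoop`; then
  `LoopConfig.measurableSet_isClose_of_gen`);
* `cnLawEDist_bond_site_le_add` — the one-line estimate
  `d_CN(bond_δ, site_δ') ≤ d_CN(bond_δ, (P, Y)) + d_CN(site_δ', (P, Y))` for EVERY probability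
  space `(Ω, P)` and every `Y : Ω → LoopConfig ℂ` (no measurability or standard-Borel hypothesis
  on the middle space: `LoopConfig.cnLawEDist_triangle` glues along the middle marginal and only
  needs the OUTER spaces standard Borel — `standardBorelSpace_bondConfig`,
  `standardBorelSpace_siteConfig` — and the OUTER exceptional event measurable, which is the
  previous item; symmetry `LoopConfig.cnLawEDist_comm`);
* `tendsto_cnLawEDist_bond_site_of_tendsto` (any filter) and the registered main theorem
  `tendsto_cnLawEDist_bond_site_of_common_limit` (mesh sequences, `atTop`) — squeeze
  (`tendsto_of_tendsto_of_tendsto_of_le_of_le` in `ℝ≥0∞`);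
* `tendsto_cnLawEDist_bond_site_of_subseq_common_limit` — the subsequence form in which
  tightness is used: `d_CN(bond_δ, site_δ) → 0` as `δ → 0⁺` as soon as every mesh sequence
  `δₖ → 0⁺` has a subsequence along which both lattice families converge in `d_CN` to a common
  law (`Filter.tendsto_of_subseq_tendsto`). Its conclusion is the route item `LoopLimitZ2EqT`
  unfolded (the item's inline `𝕋` configuration is `siteLoopConfig δ`, `siteLoopConfig_eq`,
  `rfl`; two closing `example`s check this and the `IsFullPlaneCNLLaw` usage along `𝓝[>] 0`).

What this file does NOT provide (the remaining content of `stub_transfer`): tightness /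
`d_CN`-precompactness of the two lattice families (Aizenman–Burchard regularity from RSW; not in
the tree for full-plane loop ensembles) and the identification of the two subsequential limits
from `NestingStatisticsAgree` (reconstruction of a locally finite non-crossing covering-degree-one
configuration from its nesting tree; types from the lattice).

References: H. Duminil-Copin, K. K. Kozlowski, D. Krachun, I. Manolescu, M. Oulamara,
arXiv:2012.11672v2, §1.2 eq. (1)–(2), Remark 1.8 (coupling surgery); C. Villani, *Optimal
transport* (2009), Ch. 1 (gluing lemma); F. Camia, C. M. Newman, Comm. Math. Phys. 268 (2006).
-/

noncomputable section

open MeasureTheory Set Filter Metric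
open scoped Topology ENNReal

namespace Summit.CriticalPhenomena.CardyFormulaZ2.Cruxes.NestingRigidity.RingCloudTomography

open Literature.Probability.RandomPlanarGeometry Literature.Probability.Percolation
  Literature.Probability.LatticeModels
open _root_.Summit.CriticalPhenomena.CardyFormulaZ2.Theses.CardyMagicRigidity (LoopLimitZ2EqT)

/-! ### Measurability of the mixed bond/site exceptional event -/

/-- **The mixed exceptional event of `d_CN` is measurable**: for the typed loop representation of
bond percolation on `δ e^{iα} ℤ²` against that of site percolation on `δ'𝕋`, the event
`{(ω, ω') | d_CN(bondLoopConfig δ α ω, siteLoopConfig δ' ω') ≤ ε}` is measurable on pairs of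
configurations. Both representations are countably generated with measurable generating events
(`gen_bondLoopConfig` / `measurableSet_setOf_isInterfaceLoop_and` and `gen_siteLoopConfig` /
`measurableSet_gen_siteLoopConfig`, index type countable by `countable_sigma_hexLoop`), so
`LoopConfig.measurableSet_isClose_of_gen` applies. [folklore] -/
theorem measurableSet_isClose_bondLoopConfig_siteLoopConfig (δ α δ' ε : ℝ) :
    MeasurableSet {p : BondConfig (Site 2) × SiteConfig (Site 2) |
      LoopConfig.IsClose ε (bondLoopConfig δ α p.1) (siteLoopConfig δ' p.2)} := by
  haveI := countable_sigma_hexLoop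
  exact LoopConfig.measurableSet_isClose_of_gen
    (fun i (k : {γ : List MedialVertex // γ ≠ []}) ↦ measurableSet_setOf_isInterfaceLoop_and k.1 i)
    (gen_bondLoopConfig δ α) measurableSet_gen_siteLoopConfig (gen_siteLoopConfig δ') ε

/-- **Measurability of the mixed exceptional event at angle `0`** (the case of the route item
`LoopLimitZ2EqT`): `{(ω, ω') | d_CN(bondLoopConfig δ 0 ω, siteLoopConfig δ' ω') ≤ ε}` is
measurable on `BondConfig (Site 2) × SiteConfig (Site 2)`. This is the hypothesis `hm` of
`LoopConfig.cnLawEDist_triangle` for the outer pair (bond-`ℤ²`, site-`𝕋`). [folklore] -/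
theorem measurableSet_isClose_bond_site (δ δ' ε : ℝ) :
    MeasurableSet {p : BondConfig (Site 2) × SiteConfig (Site 2) |
      LoopConfig.IsClose ε (bondLoopConfig δ 0 p.1) (siteLoopConfig δ' p.2)} :=
  measurableSet_isClose_bondLoopConfig_siteLoopConfig δ 0 δ' ε

/-! ### Gluing through a common law -/

/-- **The gluing estimate**: for every probability space `(Ω, P)` and every random typed loop
configuration `Y` on it,
`d_CN(bond_δ, site_δ') ≤ d_CN(bond_δ, (P, Y)) + d_CN(site_δ', (P, Y))`.
Proof: `LoopConfig.cnLawEDist_triangle` with middle space `(Ω, P)` (the outer spaces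
`BondConfig (Site 2)`, `SiteConfig (Site 2)` are standard Borel — `standardBorelSpace_bondConfig`,
`standardBorelSpace_siteConfig` — and the outer exceptional event is measurable,
`measurableSet_isClose_bond_site`), then symmetry of `d_CN` (`LoopConfig.cnLawEDist_comm`) in the
second summand. No hypothesis on `Y`. [folklore] -/
theorem cnLawEDist_bond_site_le_add {Ω : Type*} [MeasurableSpace Ω] (P : Measure Ω)
    [IsProbabilityMeasure P] (Y : Ω → LoopConfig ℂ) (δ δ' : ℝ) :
    LoopConfig.cnLawEDist (bondPercolation (zdGraph 2) half) (bondLoopConfig δ 0)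
        (triSitePercolation half) (siteLoopConfig δ') ≤
      LoopConfig.cnLawEDist (bondPercolation (zdGraph 2) half) (bondLoopConfig δ 0) P Y +
        LoopConfig.cnLawEDist (triSitePercolation half) (siteLoopConfig δ') P Y := by
  haveI := standardBorelSpace_bondConfig
  haveI := standardBorelSpace_siteConfig
  calc LoopConfig.cnLawEDist (bondPercolation (zdGraph 2) half) (bondLoopConfig δ 0)
        (triSitePercolation half) (siteLoopConfig δ')
      ≤ LoopConfig.cnLawEDist (bondPercolation (zdGraph 2) half) (bondLoopConfig δ 0) P Y +
          LoopConfig.cnLawEDist P Y (triSitePercolation half) (siteLoopConfig δ') :=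
        LoopConfig.cnLawEDist_triangle (bondPercolation (zdGraph 2) half) P (triSitePercolation half)
          (bondLoopConfig δ 0) Y (siteLoopConfig δ') (measurableSet_isClose_bond_site δ δ')
    _ = _ := by rw [LoopConfig.cnLawEDist_comm P Y]

/-- **Gluing through a common limit, along any filter**: if along `l` the bond-`ℤ²` ensembles at
meshes `δs i` and the site-`𝕋` ensembles at meshes `δs' i` both converge in `d_CN` to the same law
`(P, Y)`, then `d_CN(bond_{δs i}, site_{δs' i}) → 0` along `l` (squeeze with
`cnLawEDist_bond_site_le_add`). [folklore] -/
theorem tendsto_cnLawEDist_bond_site_of_tendsto {Ω : Type*} [MeasurableSpace Ω] (P : Measure Ω)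
    [IsProbabilityMeasure P] (Y : Ω → LoopConfig ℂ) {ι : Type*} {l : Filter ι} (δs δs' : ι → ℝ)
    (hZ : Tendsto (fun i ↦ LoopConfig.cnLawEDist (bondPercolation (zdGraph 2) half)
      (bondLoopConfig (δs i) 0) P Y) l (𝓝 0))
    (hT : Tendsto (fun i ↦ LoopConfig.cnLawEDist (triSitePercolation half)
      (siteLoopConfig (δs' i)) P Y) l (𝓝 0)) :
    Tendsto (fun i ↦ LoopConfig.cnLawEDist (bondPercolation (zdGraph 2) half)
      (bondLoopConfig (δs i) 0) (triSitePercolation half) (siteLoopConfig (δs' i))) l (𝓝 0) := by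
  refine tendsto_of_tendsto_of_tendsto_of_le_of_le tendsto_const_nhds ?_ (fun _ ↦ bot_le)
    fun i ↦ cnLawEDist_bond_site_le_add P Y (δs i) (δs' i)
  simpa using hZ.add hT

/-- **Gluing through a common limit (T4 of stub `stub_transfer`)**: if along a mesh sequence
`δs` the typed loop ensembles of critical bond percolation on `δs k · ℤ²` and of critical site
percolation on `δs k · 𝕋` converge in DKKMO's coupling distance `d_CN` to a COMMON law `(P, Y)`
on some probability space, then `d_CN(bond_{δs k}, site_{δs k}) → 0`. The middle space needs no
standard-Borel or measurability hypothesis: `LoopConfig.cnLawEDist_triangle` is applied with the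
lattice spaces as the outer pair (standard Borel: `standardBorelSpace_bondConfig`,
`standardBorelSpace_siteConfig`; measurable mixed exceptional event:
`measurableSet_isClose_bond_site`). [folklore] -/
theorem tendsto_cnLawEDist_bond_site_of_common_limit : ∀ {Ω : Type*} [MeasurableSpace Ω] (P : Measure Ω) [IsProbabilityMeasure P] (Y : Ω → LoopConfig ℂ) (δs : ℕ → ℝ), Tendsto (fun k ↦ LoopConfig.cnLawEDist (bondPercolation (zdGraph 2) half) (bondLoopConfig (δs k) 0) P Y) atTop (𝓝 0) → Tendsto (fun k ↦ LoopConfig.cnLawEDist (triSitePercolation half) (siteLoopConfig (δs k)) P Y) atTop (𝓝 0) → Tendsto (fun k ↦ LoopConfig.cnLawEDist (bondPercolation (zdGraph 2) half) (bondLoopConfig (δs k) 0) (triSitePercolation half) (siteLoopConfig (δs k))) atTop (𝓝 0) := by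
  intro Ω _ P _ Y δs hZ hT
  exact tendsto_cnLawEDist_bond_site_of_tendsto P Y δs δs hZ hT

/-! ### Along `δ → 0⁺`: the shape of the route item `LoopLimitZ2EqT` -/

/-- **Subsequence form (where tightness enters)**: `d_CN(bond_δ, site_δ) → 0` as `δ → 0⁺`
(= `LoopLimitZ2EqT` unfolded, `siteLoopConfig_eq`) as soon as every mesh sequence `δs → 0⁺` has a
subsequence `δs ∘ φ` along which the bond-`ℤ²` and the site-`𝕋` typed loop ensembles converge in
`d_CN` to a COMMON law presented on the probability space `(Ω, P)`
(`Filter.tendsto_of_subseq_tendsto` + `tendsto_cnLawEDist_bond_site_of_common_limit`). In the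
intended proof of `stub_transfer` the subsequence and the two limits come from tightness
(Aizenman–Burchard regularity of both lattice families) and "common" from the identification of
the two limits through `NestingStatisticsAgree`. [folklore] -/
theorem tendsto_cnLawEDist_bond_site_of_subseq_common_limit {Ω : Type*} [MeasurableSpace Ω]
    (P : Measure Ω) [IsProbabilityMeasure P]
    (h : ∀ δs : ℕ → ℝ, Tendsto δs atTop (𝓝[>] (0 : ℝ)) → ∃ (φ : ℕ → ℕ) (Y : Ω → LoopConfig ℂ),
      Tendsto (fun k ↦ LoopConfig.cnLawEDist (bondPercolation (zdGraph 2) half)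
        (bondLoopConfig (δs (φ k)) 0) P Y) atTop (𝓝 0) ∧
      Tendsto (fun k ↦ LoopConfig.cnLawEDist (triSitePercolation half)
        (siteLoopConfig (δs (φ k))) P Y) atTop (𝓝 0)) :
    Tendsto (fun δ : ℝ ↦ LoopConfig.cnLawEDist (bondPercolation (zdGraph 2) half)
      (bondLoopConfig δ 0) (triSitePercolation half) (siteLoopConfig δ)) (𝓝[>] 0) (𝓝 0) := by
  refine Filter.tendsto_of_subseq_tendsto fun δs hδs ↦ ?_
  obtain ⟨φ, Y, hZ, hT⟩ := h δs hδs
  exact ⟨φ, tendsto_cnLawEDist_bond_site_of_common_limit P Y (δs ∘ φ) hZ hT⟩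

/-- Sanity check (not a theorem of the file's interface): the common conclusion above IS the
route item `LoopLimitZ2EqT`, definitionally (`siteLoopConfig_eq`). -/
example : LoopLimitZ2EqT ↔ Tendsto (fun δ : ℝ ↦ LoopConfig.cnLawEDist
    (bondPercolation (zdGraph 2) half) (bondLoopConfig δ 0) (triSitePercolation half)
      (siteLoopConfig δ)) (𝓝[>] 0) (𝓝 0) :=
  Iff.rfl

/-- Usage check (not a theorem of the file's interface): a common `d_CN`-limit `(P, Y)` of the
bond-`ℤ²` ensembles along `δ → 0⁺` which is a full-plane CNL law (`IsFullPlaneCNLLaw P Y`: the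
site-`𝕋` ensembles converge to it, Camia–Newman) gives the route item, by
`tendsto_cnLawEDist_bond_site_of_tendsto` along `𝓝[>] 0`. -/
example {Ω : Type*} [MeasurableSpace Ω] (P : Measure Ω) [IsProbabilityMeasure P]
    (Y : Ω → LoopConfig ℂ)
    (hZ : Tendsto (fun δ : ℝ ↦ LoopConfig.cnLawEDist (bondPercolation (zdGraph 2) half)
      (bondLoopConfig δ 0) P Y) (𝓝[>] 0) (𝓝 0))
    (hT : IsFullPlaneCNLLaw P Y) : LoopLimitZ2EqT :=
  tendsto_cnLawEDist_bond_site_of_tendsto P Y id id hZ (isFullPlaneCNLLaw_iff.1 hT)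

end Summit.CriticalPhenomena.CardyFormulaZ2.Cruxes.NestingRigidity.RingCloudTomography

end
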